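import Summits.CriticalPhenomena.Ising3DConformalLimit.Theses.MonotoneBlocking
import Summits.CriticalPhenomena.Ising3DConformalLimit.Theorems.InversionUpgradeNormalised.Negative.LoadBearingHypotheses
import Summits.CriticalPhenomena.Ising3DConformalLimit.Theorems.RotationUpgradeFromTwoPoint.Negative.LoadBearingHypotheses
import Summits.CriticalPhenomena.Ising3DConformalLimit.Theorems.RotationUpgradeFromTwoPoint.Negative.AutomaticOrders
import Literature.Probability.LatticeModels.GeneralisedFreeFamily
import Literature.Probability.LatticeModels.PointwiseScalingLimitScale
import Literature.Probability.LatticeModels.HighDimPointwiseTriviality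
import Summits.CriticalPhenomena.Ising3DConformalLimit.Theorems.JoinForcesU4.Negative.LoadBearing

/-!
# `LimitsAreConformal` (item stmt-CriticalPhenomena-6154): load-bearing hypotheses, conclusion audit, dimension sharpness

Negative / structural knowledge about the crux
`Summit.CriticalPhenomena.Ising3DConformalLimit.Theses.MonotoneBlocking.LimitsAreConformal`
(shared VERBATIM with `…Theses.MirrorHoelderCompactness.LimitsAreConformal`, tree
`LimitsAreConformalSplit.monotoneBlocking_iff_mirror`), standing crux disprover, cycle 1 (D-0016);
THEOREM-ONLY. Hypotheses on `(ρ, Δ, S)`: (H1) `ρ > 0` on `(0,1]`;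
(H2) `HasPointwiseScalingLimit (criticalCorr 3) ρ S`; (H3) `S = 0` off `NonCoincident`;
(H4) `IsNondegenerateTwoPoint S`; (H5) `IsTranslationInvariant S`; (H6) `IsScaleCovariant Δ S`;
conclusion (i) `IsRotationInvariant S` ∧ (ii) `IsInversionCovariant Δ S` ∧ (iii) `HasNontrivialU4 S`.

* (H1) COSMETIC: `limitsAreConformal_iff_withoutPositivity` (odd critical correlators vanish; `|ρ|` has
  the same limit; `ρ ≠ 0` eventually is forced by (H2)+(H4)).
* (H2) LOAD-BEARING, clause by clause, at every `Δ` of the window: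
  `limitsAreConformal_false_without_isingLimit`; `rotation_clause_needs_lattice` (cubic decoy: (H3)–(H6),
  not (i)); `inversion_clause_needs_lattice` (barrier `narrowFamily`: (H3)–(H6) + (i) + (iii), not (ii));
  `u4_clause_needs_lattice` (normalised generalised free field: (H3)–(H6) + (i) + (ii), not (iii)) — the
  three conjuncts are INDEPENDENT model-blindly (`conjuncts_independent`); and lattice PROVENANCE does not
  rescue (H2) (`limitsAreConformal_false_with_latticeLimit`): a proof must use properties specific to
  `criticalCorr 3`.
* (H3) LOAD-BEARING given satisfiability (item 1981 `HyperoctahedralRP.ExistsScaleCovariantLimit`):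
  `limitsAreConformal_false_without_normalisation_of_exists` (decorate `S₃` on the coincident locus).
* (H4): see `Negative/Nondegeneracy.lean` (load-bearing unconditionally, only through (iii)).
* (H5) REDUNDANT: `limitsAreConformal_iff_withoutTranslation`.
* (H6) LOAD-BEARING given satisfiability: `limitsAreConformal_false_without_scaleCovariance_of_exists`
  (it is what binds `Δ`).
* `hypotheses_satisfiable_iff`: (H1)–(H6) satisfiable ↔ item 1981 (`0 < Δ` automatic, `Δ ∈ [1/2,1]`).
* CONCLUSION AUDIT: `limitsAreConformal_iff_strong` (free upgrade to `IsMoebiusCovariant Δ S`,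
  `Δ ∈ [1/2,1]`, `S₀ ≡ 1`, odd orders `≡ 0`); `conclusion_weight_forced` ((ii) with any weight forces it
  to be `Δ`); the origin guard of (ii) is necessary (`InversionUpgradeNormalisedNegative.not_unguarded`).
* DIMENSION SHARPNESS: `limitsAreConformalAt_iff_vacuous_of_five_le` — the same statement on `ℤ^d`,
  `d ≥ 5`, holds iff its hypotheses are unsatisfiable (every non-degenerate limit is Gaussian there):
  a proof for `d = 3` must use an input that FAILS for `d ≥ 5`.
-/

noncomputable section

namespace Summit.CriticalPhenomena.Ising3DConformalLimit.LimitsAreConformalNegative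

open Literature.Probability.LatticeModels Literature.Barriers.CriticalPhenomena
open Filter Set Function EuclideanGeometry ScaleNotMoebius
open scoped Topology
open Summit.CriticalPhenomena.Ising3DConformalLimit.Theses
open Summit.CriticalPhenomena.Ising3DConformalLimit.RotationUpgradeFromTwoPointNegative
  (cubicFamily cubicLattice cubicFamily_eq_zero_of_not_mem cubicFamily_isNondegenerateTwoPoint
    cubicFamily_isTranslationInvariant cubicFamily_isScaleCovariant cubicFamily_not_isRotationInvariant
    cubicFamily_hasPointwiseScalingLimit decorate decor decorate_lim decorate_nondeg decorate_transl
    decorate_scale swap01 coincidentTriple decor_swap_coincidentTriple decor_coincidentTriple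
    translation_redundant)
open Summit.CriticalPhenomena.Ising3DConformalLimit.InversionUpgradeNormalisedNegative
  (weight_unique_of_two delta_mem_Icc_of_hyp limit_zero_eq_one limit_odd_eq_zero inversion_weight_eq)
open Summit.CriticalPhenomena.Ising3DConformalLimit.MoebiusLimitExistsNegative
  (normalised_nondeg normalised_translation normalised_rotation normalised_inversion normalised_scale
    hasNontrivialU4_normalised_iff)

/-! ## §A.1 (H1) positivity of `ρ` is COSMETIC -/

/-- **(H1) is cosmetic**: the crux is equivalent to its version with NO condition on `ρ`. (Odd critical
correlators vanish since `m*(β_c) = 0`, so `|ρ|` has the same limit as `ρ`; `ρ ≠ 0` eventually by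
(H2)+(H4), tree `JoinForcesU4.Negative.eventually_ne_zero_of_limit`;
`HasPointwiseScalingLimit.exists_pos_renormalisation`.) A prover may fix any sign convention; a refuter
gains nothing from exotic `ρ`. [folklore] -/
theorem limitsAreConformal_iff_withoutPositivity :
    MonotoneBlocking.LimitsAreConformal ↔
      ∀ (ρ : ℝ → ℝ) (Δ : ℝ) (S : CorrFamily 3), HasPointwiseScalingLimit (criticalCorr 3) ρ S →
        (∀ n z, z ∉ NonCoincident 3 n → S n z = 0) → IsNondegenerateTwoPoint S →
        IsTranslationInvariant S → IsScaleCovariant Δ S →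
        IsRotationInvariant S ∧ IsInversionCovariant Δ S ∧ HasNontrivialU4 S := by
  refine ⟨fun h ρ Δ S hlim hnorm hnd htr hsc => ?_,
    fun h ρ Δ S _ hlim hnorm hnd htr hsc => h ρ Δ S hlim hnorm hnd htr hsc⟩
  obtain ⟨ρ', hρ', hlim'⟩ := hlim.exists_pos_renormalisation
    (fun n hn y => criticalCorr_eq_zero_of_odd le_rfl hn y)
    (Summit.CriticalPhenomena.Ising3DConformalLimit.Theorems.JoinForcesU4.Negative.eventually_ne_zero_of_limit hlim hnd)
  exact h ρ' Δ S (fun δ _ => hρ' δ) hlim' hnorm hnd htr hsc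

/-! ## §A.2 (H2) the Ising lattice clause is LOAD-BEARING — clause by clause -/

/-- **(H2) is load-bearing** (witness: the barrier family `ScaleNotMoebius.narrowFamily 1`, which has
(H3)–(H6), (i), (iii) and fails (ii)). [folklore] -/
theorem limitsAreConformal_false_without_isingLimit :
    ¬ ∀ (Δ : ℝ) (S : CorrFamily 3), (∀ n z, z ∉ NonCoincident 3 n → S n z = 0) →
        IsNondegenerateTwoPoint S → IsTranslationInvariant S → IsScaleCovariant Δ S →
        IsRotationInvariant S ∧ IsInversionCovariant Δ S ∧ HasNontrivialU4 S := fun h =>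
  narrowFamily_not_isInversionCovariant one_pos
    (h 1 _ (narrowFamily_eq_zero_of_not_mem one_ne_zero) (narrowFamily_isNondegenerateTwoPoint 1)
      (narrowFamily_isTranslationInvariant 1) (narrowFamily_isScaleCovariant 1)).2.1

/-- **Clause (i) needs the lattice**, at every `Δ ≠ 0`: the cubic decoy has (H3)–(H6) and is not
`O(3)` invariant. [folklore] -/
theorem rotation_clause_needs_lattice {Δ : ℝ} (hΔ : Δ ≠ 0) :
    ∃ S : CorrFamily 3, (∀ n z, z ∉ NonCoincident 3 n → S n z = 0) ∧ IsNondegenerateTwoPoint S ∧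
      IsTranslationInvariant S ∧ IsScaleCovariant Δ S ∧ ¬ IsRotationInvariant S :=
  ⟨cubicFamily Δ, cubicFamily_eq_zero_of_not_mem hΔ, cubicFamily_isNondegenerateTwoPoint Δ,
    cubicFamily_isTranslationInvariant Δ, cubicFamily_isScaleCovariant Δ,
    cubicFamily_not_isRotationInvariant Δ⟩

/-- **Clause (ii) needs the lattice EVEN GIVEN (i) and (iii)**, at every `Δ > 0`: the barrier family
`narrowFamily Δ` has (H3)–(H6), is `O(3)` invariant and non-Gaussian, and is NOT inversion covariant.
[folklore] -/
theorem inversion_clause_needs_lattice {Δ : ℝ} (hΔ : 0 < Δ) :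
    ∃ S : CorrFamily 3, (∀ n z, z ∉ NonCoincident 3 n → S n z = 0) ∧ IsNondegenerateTwoPoint S ∧
      IsTranslationInvariant S ∧ IsScaleCovariant Δ S ∧ IsRotationInvariant S ∧ HasNontrivialU4 S ∧
      ¬ IsInversionCovariant Δ S :=
  ⟨narrowFamily Δ, narrowFamily_eq_zero_of_not_mem hΔ.ne', narrowFamily_isNondegenerateTwoPoint Δ,
    narrowFamily_isTranslationInvariant Δ, narrowFamily_isScaleCovariant Δ,
    narrowFamily_isRotationInvariant Δ, narrowFamily_hasNontrivialU4 Δ,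
    narrowFamily_not_isInversionCovariant hΔ⟩

open Classical in
/-- **Clause (iii) needs the lattice EVEN GIVEN (i) and (ii)**, at every `Δ`: the normalised
generalised free field of dimension `Δ` has (H3)–(H6), is fully Möbius covariant, and has `U₄ ≡ 0`.
So no list of covariance properties replaces the lattice clause for (iii). [cite: FrancescoMathieuSenechal1997, §4.3.1] -/
theorem u4_clause_needs_lattice (Δ : ℝ) :
    ∃ S : CorrFamily 3, (∀ n z, z ∉ NonCoincident 3 n → S n z = 0) ∧ IsNondegenerateTwoPoint S ∧
      IsTranslationInvariant S ∧ IsScaleCovariant Δ S ∧ IsRotationInvariant S ∧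
      IsInversionCovariant Δ S ∧ ¬ HasNontrivialU4 S := by
  refine ⟨fun n x => if x ∈ NonCoincident 3 n then gffFamily Δ n x else 0, fun n z hz => if_neg hz,
    normalised_nondeg (isNondegenerateTwoPoint_gff Δ), normalised_translation (isTranslationInvariant_gff Δ),
    normalised_scale (isScaleCovariant_gff Δ), normalised_rotation (isRotationInvariant_gff Δ),
    normalised_inversion (isInversionCovariant_gff Δ), ?_⟩
  rw [hasNontrivialU4_normalised_iff]
  exact not_hasNontrivialU4_gff Δ

/-- The three conjuncts are INDEPENDENT model-blindly (summary of the three witnesses): for every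
`Δ > 0` each conjunct fails for some family having (H3)–(H6) and the OTHER symmetry data listed.
[folklore] -/
theorem conjuncts_independent {Δ : ℝ} (hΔ : 0 < Δ) :
    (∃ S : CorrFamily 3, (∀ n z, z ∉ NonCoincident 3 n → S n z = 0) ∧ IsNondegenerateTwoPoint S ∧
      IsTranslationInvariant S ∧ IsScaleCovariant Δ S ∧ ¬ IsRotationInvariant S) ∧
    (∃ S : CorrFamily 3, (∀ n z, z ∉ NonCoincident 3 n → S n z = 0) ∧ IsNondegenerateTwoPoint S ∧
      IsTranslationInvariant S ∧ IsScaleCovariant Δ S ∧ IsRotationInvariant S ∧ HasNontrivialU4 S ∧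
      ¬ IsInversionCovariant Δ S) ∧
    (∃ S : CorrFamily 3, (∀ n z, z ∉ NonCoincident 3 n → S n z = 0) ∧ IsNondegenerateTwoPoint S ∧
      IsTranslationInvariant S ∧ IsScaleCovariant Δ S ∧ IsRotationInvariant S ∧
      IsInversionCovariant Δ S ∧ ¬ HasNontrivialU4 S) :=
  ⟨rotation_clause_needs_lattice hΔ.ne', inversion_clause_needs_lattice hΔ, u4_clause_needs_lattice Δ⟩

/-- **Lattice PROVENANCE does not rescue (H2)**: being the full-filter scaling limit of SOME lattice
family (here the cubic decoy sampled on `ℤ³`, `ρ δ = δ⁻¹`) with (H1),(H3)–(H6) does not give (i). A proof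
must use properties SPECIFIC to `criticalCorr 3` (reflection positivity of all orders, random currents,
switching), not "is a lattice limit". [folklore] -/
theorem limitsAreConformal_false_with_latticeLimit :
    ¬ ∀ (G : LatticeCorrFamily 3) (ρ : ℝ → ℝ) (Δ : ℝ) (S : CorrFamily 3), (∀ δ ∈ Set.Ioc (0:ℝ) 1, 0 < ρ δ) →
        HasPointwiseScalingLimit G ρ S → (∀ n z, z ∉ NonCoincident 3 n → S n z = 0) →
        IsNondegenerateTwoPoint S → IsTranslationInvariant S → IsScaleCovariant Δ S →
        IsRotationInvariant S ∧ IsInversionCovariant Δ S ∧ HasNontrivialU4 S := fun h =>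
  cubicFamily_not_isRotationInvariant 1 (h (cubicLattice 1) (fun δ => δ ^ (-(1:ℝ))) 1 (cubicFamily 1)
    (fun _ hδ => Real.rpow_pos_of_pos hδ.1 _) (cubicFamily_hasPointwiseScalingLimit 1)
    (cubicFamily_eq_zero_of_not_mem one_ne_zero) (cubicFamily_isNondegenerateTwoPoint 1)
    (cubicFamily_isTranslationInvariant 1) (cubicFamily_isScaleCovariant 1)).1

/-! ## §A.3 (H3) normalisation is LOAD-BEARING (given satisfiability) -/

/-- Decorating a family with `S₃ ≡ 0` on the coincident locus of order `3` (the sibling disprover's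
`decorate`, `Theorems/RotationUpgradeFromTwoPoint/Negative/CoincidentDecoration.lean`) destroys `O(3)`
invariance: the coincident triple `(0,0,e₀)` versus its coordinate swap, values `1` versus `0`. [folklore] -/
theorem decorate_not_rot_of_three (Δ : ℝ) {S : CorrFamily 3} (h3 : ∀ x, S 3 x = 0) :
    ¬ IsRotationInvariant (decorate Δ S) := by
  intro h
  have key := h 3 swap01 coincidentTriple
  change S 3 (fun i => swap01 (coincidentTriple i)) + decor Δ (fun i => swap01 (coincidentTriple i)) =
    S 3 coincidentTriple + decor Δ coincidentTriple at key
  rw [h3, h3, decor_swap_coincidentTriple, decor_coincidentTriple] at key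
  norm_num at key

/-- **(H3) is load-bearing as soon as the hypotheses are satisfiable** (item 1981,
`HyperoctahedralRP.ExistsScaleCovariantLimit`): decorate the normalised limit at order `3` on the
coincident locus — (H2) is blind there (it only sees `NonCoincident`), (H1),(H4),(H5),(H6) survive, and
(i) fails. (A normalised limit has `S₃ ≡ 0`: odd orders vanish.) [folklore] -/
theorem limitsAreConformal_false_without_normalisation_of_exists
    (hE : HyperoctahedralRP.ExistsScaleCovariantLimit) :
    ¬ ∀ (ρ : ℝ → ℝ) (Δ : ℝ) (S : CorrFamily 3), (∀ δ ∈ Set.Ioc (0:ℝ) 1, 0 < ρ δ) →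
        HasPointwiseScalingLimit (criticalCorr 3) ρ S → IsNondegenerateTwoPoint S →
        IsTranslationInvariant S → IsScaleCovariant Δ S →
        IsRotationInvariant S ∧ IsInversionCovariant Δ S ∧ HasNontrivialU4 S := by
  obtain ⟨ρ, Δ, S, hρ, -, hlim, hnorm, hnd, htr, hsc⟩ := hE
  intro h
  have h3 : ∀ x, S 3 x = 0 := fun x => limit_odd_eq_zero hlim hnorm (by decide) x
  exact decorate_not_rot_of_three Δ h3 (h ρ Δ (decorate Δ S) hρ (decorate_lim Δ hlim)
    (decorate_nondeg Δ hnd) (decorate_transl Δ htr) (decorate_scale hsc)).1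

/-! ## §A.5 (H5) translation invariance is REDUNDANT -/

/-- **(H5) is redundant**: the crux is equivalent to its version with `IsTranslationInvariant S`
deleted (lattice translation invariance passes to normalised pointwise limits,
`RotationUpgradeFromTwoPointNegative.translation_redundant`). [cite: FriedliVelenik2017, Thm. 3.17] -/
theorem limitsAreConformal_iff_withoutTranslation :
    MonotoneBlocking.LimitsAreConformal ↔ ∀ (ρ : ℝ → ℝ) (Δ : ℝ) (S : CorrFamily 3), (∀ δ ∈ Set.Ioc (0:ℝ) 1, 0 < ρ δ) →
      HasPointwiseScalingLimit (criticalCorr 3) ρ S → (∀ n z, z ∉ NonCoincident 3 n → S n z = 0) →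
      IsNondegenerateTwoPoint S → IsScaleCovariant Δ S →
      IsRotationInvariant S ∧ IsInversionCovariant Δ S ∧ HasNontrivialU4 S := by
  constructor
  · intro h ρ Δ S h1 h2 h3 h4 h6
    exact h ρ Δ S h1 h2 h3 h4 (translation_redundant h2 h3) h6
  · intro h ρ Δ S h1 h2 h3 h4 _ h6
    exact h ρ Δ S h1 h2 h3 h4 h6

/-! ## §A.6 (H6) scale covariance is LOAD-BEARING (given satisfiability): it binds `Δ` -/

/-- **(H6) is load-bearing as soon as the hypotheses are satisfiable**: without it `Δ` is free, so (ii)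
would hold with weights `Δ` and `Δ + 1` for the same non-degenerate `S` — impossible
(`weight_unique_of_two`, pair `(e₀, 2e₀)`). [folklore] -/
theorem limitsAreConformal_false_without_scaleCovariance_of_exists
    (hE : HyperoctahedralRP.ExistsScaleCovariantLimit) :
    ¬ ∀ (ρ : ℝ → ℝ) (Δ : ℝ) (S : CorrFamily 3), (∀ δ ∈ Set.Ioc (0:ℝ) 1, 0 < ρ δ) →
        HasPointwiseScalingLimit (criticalCorr 3) ρ S → (∀ n z, z ∉ NonCoincident 3 n → S n z = 0) →
        IsNondegenerateTwoPoint S → IsTranslationInvariant S →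
        IsRotationInvariant S ∧ IsInversionCovariant Δ S ∧ HasNontrivialU4 S := by
  obtain ⟨ρ, Δ, S, hρ, -, hlim, hnorm, hnd, htr, -⟩ := hE
  intro h
  have h1 := (h ρ Δ S hρ hlim hnorm hnd htr).2.1
  have h2 := (h ρ (Δ + 1) S hρ hlim hnorm hnd htr).2.1
  have := weight_unique_of_two hnd (h1 2) (h2 2)
  linarith

/-! ## §A.7 Satisfiability of the hypotheses = item 1981 (no junk instance, no hidden vacuity) -/

/-- **The hypotheses (H1)–(H6) are jointly satisfiable iff `ExistsScaleCovariantLimit` (item 1981)**;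
`0 < Δ` is automatic (`Δ ∈ [1/2,1]`, infrared bound + Simon–Lieb). So the crux is vacuous exactly when
1981 fails, and otherwise speaks about the (unique up to `c^n`) Ising₃ limit. [cite: Simon1980, Thm. 1] -/
theorem hypotheses_satisfiable_iff :
    (∃ (ρ : ℝ → ℝ) (Δ : ℝ) (S : CorrFamily 3), (∀ δ ∈ Set.Ioc (0:ℝ) 1, 0 < ρ δ) ∧
      HasPointwiseScalingLimit (criticalCorr 3) ρ S ∧ (∀ n z, z ∉ NonCoincident 3 n → S n z = 0) ∧
      IsNondegenerateTwoPoint S ∧ IsTranslationInvariant S ∧ IsScaleCovariant Δ S) ↔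
    HyperoctahedralRP.ExistsScaleCovariantLimit := by
  constructor
  · rintro ⟨ρ, Δ, S, h1, h2, h3, h4, h5, h6⟩
    exact ⟨ρ, Δ, S, h1, by linarith [(delta_mem_Icc_of_hyp h1 h2 h4 h6).1], h2, h3, h4, h5, h6⟩
  · rintro ⟨ρ, Δ, S, h1, -, h2, h3, h4, h5, h6⟩
    exact ⟨ρ, Δ, S, h1, h2, h3, h4, h5, h6⟩

/-! ## §B Conclusion audit: free strengthening, forced weight -/

/-- **The conclusion upgrades for free**: the crux is equivalent to the version concluding full Möbius
covariance `IsMoebiusCovariant Δ S` (translations are (H5), rotations (i), dilations (H6), inversion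
(ii)), non-Gaussianity, `Δ ∈ [1/2, 1]`, `S₀ ≡ 1` and vanishing odd orders. [cite: Simon1980, Thm. 1] -/
theorem limitsAreConformal_iff_strong :
    MonotoneBlocking.LimitsAreConformal ↔ ∀ (ρ : ℝ → ℝ) (Δ : ℝ) (S : CorrFamily 3), (∀ δ ∈ Set.Ioc (0:ℝ) 1, 0 < ρ δ) →
      HasPointwiseScalingLimit (criticalCorr 3) ρ S → (∀ n z, z ∉ NonCoincident 3 n → S n z = 0) →
      IsNondegenerateTwoPoint S → IsTranslationInvariant S → IsScaleCovariant Δ S →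
      IsMoebiusCovariant Δ S ∧ HasNontrivialU4 S ∧ Δ ∈ Set.Icc (1 / 2 : ℝ) 1 ∧
        (∀ x, S 0 x = 1) ∧ (∀ n, Odd n → ∀ x, S n x = 0) := by
  constructor
  · intro h ρ Δ S h1 h2 h3 h4 h5 h6
    obtain ⟨hrot, hinv, hU⟩ := h ρ Δ S h1 h2 h3 h4 h5 h6
    exact ⟨⟨⟨h5, hrot⟩, h6, hinv⟩, hU, delta_mem_Icc_of_hyp h1 h2 h4 h6,
      fun x => limit_zero_eq_one h2 x, fun n hn x => limit_odd_eq_zero h2 h3 hn x⟩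
  · intro h ρ Δ S h1 h2 h3 h4 h5 h6
    obtain ⟨hM, hU, -⟩ := h ρ Δ S h1 h2 h3 h4 h5 h6
    exact ⟨hM.1.2, hM.2.2, hU⟩

/-- **The weight in (ii) is forced**: under (H3)–(H6) and (i), inversion covariance with ANY weight
`Δ'` gives `Δ' = Δ` — "with the same Δ" in the crux costs nothing, and proving (ii) "for some weight"
proves it for `Δ`. [folklore] -/
theorem conclusion_weight_forced {Δ Δ' : ℝ} {S : CorrFamily 3}
    (hnorm : ∀ n z, z ∉ NonCoincident 3 n → S n z = 0) (hnd : IsNondegenerateTwoPoint S)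
    (htr : IsTranslationInvariant S) (hsc : IsScaleCovariant Δ S) (hrot : IsRotationInvariant S)
    (hinv : IsInversionCovariant Δ' S) : Δ' = Δ :=
  inversion_weight_eq hnorm hnd ⟨htr, hrot⟩ hsc hinv

/-! ## §C Dimension sharpness: the same statement in `d ≥ 5` is vacuous-or-false -/

/-- **`d ≥ 5`: the same statement holds iff it is VACUOUS** (every non-degenerate pointwise limit of
`criticalCorr d`, `d ≥ 5`, has `U₄ ≡ 0`: tree theorem
`limitConnectedFour_eq_zero_of_hasPointwiseScalingLimit_holds`, Aizenman 1982 / Fröhlich 1982). So clause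
(iii) on `ℤ³` is a `d < 4` phenomenon: a proof must use an input that FAILS in `d ≥ 5`, beyond RP, GKS,
Lebowitz, MMS and infrared bounds (all dimension-uniform). [cite: Aizenman1982, §1] -/
theorem limitsAreConformalAt_iff_vacuous_of_five_le {d : ℕ} (hd : 5 ≤ d) :
    (∀ (ρ : ℝ → ℝ) (Δ : ℝ) (S : CorrFamily d), (∀ δ ∈ Set.Ioc (0:ℝ) 1, 0 < ρ δ) →
      HasPointwiseScalingLimit (criticalCorr d) ρ S → (∀ n z, z ∉ NonCoincident d n → S n z = 0) →
      IsNondegenerateTwoPoint S → IsTranslationInvariant S → IsScaleCovariant Δ S →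
      IsRotationInvariant S ∧ IsInversionCovariant Δ S ∧ HasNontrivialU4 S) ↔
    ¬ ∃ (ρ : ℝ → ℝ) (Δ : ℝ) (S : CorrFamily d), (∀ δ ∈ Set.Ioc (0:ℝ) 1, 0 < ρ δ) ∧
      HasPointwiseScalingLimit (criticalCorr d) ρ S ∧ (∀ n z, z ∉ NonCoincident d n → S n z = 0) ∧
      IsNondegenerateTwoPoint S ∧ IsTranslationInvariant S ∧ IsScaleCovariant Δ S := by
  constructor
  · rintro h ⟨ρ, Δ, S, h1, h2, h3, h4, h5, h6⟩
    obtain ⟨x, hx, hne⟩ := (h ρ Δ S h1 h2 h3 h4 h5 h6).2.2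
    exact hne (limitConnectedFour_eq_zero_of_hasPointwiseScalingLimit_holds hd ρ S h1 h2 h4 x hx)
  · intro h ρ Δ S h1 h2 h3 h4 h5 h6
    exact absurd ⟨ρ, Δ, S, h1, h2, h3, h4, h5, h6⟩ h

end Summit.CriticalPhenomena.Ising3DConformalLimit.LimitsAreConformalNegative

end
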